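import Mathlib
import Summits.KontsevichZagierPeriods.KontsevichZagierPeriods.Theorems.SoloInformedKZSaturation
import HarnessLib
import HarnessLib.Audit

/-!
# SoloInformed — localisation splitting: the summit is "the localised conjecture ∧ one cancellation"

`Theorems/SoloInformedKZSaturation.lean` and `Theorems/SoloInformedPiSat.lean` proved, granting
separation of poles, Nash cubulation and Ayoub's conjecture in localised form, that the
Kontsevich–Zagier period conjecture (KZP) is equivalent to a cancellation statement in the formal
period ring `P = FormalRep ⧸ relations` (`KZSat`, resp. the one-element form `PiSatTheta`).  Here the
hypotheses are removed at the price of keeping the localised conjecture as an explicit conjunct,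
which gives an UNCONDITIONAL and exact two-conjunct decomposition of the summit at every formal
period of non-zero value:

* `soloInformed_injective_iff_loc_and_cancel` — pure algebra: for a ring map `f : R → K` to a
  field and `s ∈ R` with `f s ≠ 0`, `f` is injective iff its extension `R[s⁻¹] → K` is injective
  AND `s` is a non-zero-divisor of `R` (`R → R[s⁻¹]` is injective exactly when `s` cancels, and
  `f = f_loc ∘ loc`).
* `soloInformed_kzp_iff_injective_evalP` — KZP ⟺ `evalP : P → ℝ` is injective.
* `soloInformed_kzp_iff_loc_and_cancel` — for EVERY formal period `p` with `evalP p ≠ 0`: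
  **KZP ⟺ (the period conjecture for the localised ring `P[p⁻¹]`, `SoloInformedKZLocAt p`) ∧
  (`p` is a non-zero-divisor of `P`)**; in words (`soloInformed_kzLocAt_iff`): two effective formal
  periods with the same value differ by the moves iff (a) they do so after multiplication by a
  power of `p`, and (b) multiplication by `p` can be cancelled modulo the moves.
* The instance `p = ⟦[π]⟧ = ⟦[{x²+y²≤1}, 1]⟧` places the Literature library's open statement
  `KZ.PiCancellation` [`Literature/NumberTheory/Transcendental/KZProduct.lean`] in this hierarchy:
  it is literally "`⟦[π]⟧` is a non-zero-divisor of `P`" (`soloInformed_piCancellation_iff_cancel`),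
  hence a consequence of `SoloInformedKZSat` (`soloInformed_piCancellation_of_kzSat`:
  KZP → KZDomain → KZSat → PiCancellation), and **KZP ⟺ `SoloInformedKZLocAt ⟦[π]⟧` ∧
  `KZ.PiCancellation`** (`soloInformed_kzp_iff_locPi_and_piCancellation`), no hypotheses.
  Conjunct (a) is the naive form of the period conjecture for Kontsevich–Zagier's extended ring
  `P̂ = P[(2πi)⁻¹]` [Kontsevich–Zagier 2001, §4.1] — under the comparison `P[θ⁻¹] ⊗ ℚ ≅ P̃(ℚ)`
  [Ayoub 2014, Def. 10, Prop. 11; Huber–Müller-Stach 2017, Prop. 13.2.21], of Grothendieck's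
  period conjecture for all Nori motives over `ℚ`; conjunct (b) is the naive form of
  "`MM^eff_Nori(ℚ) ⊂ MM_Nori(ℚ)` is full", i.e. `P̃^eff(ℚ) → P̃(ℚ)` injective, recorded as open in
  [Huber–Müller-Stach 2017, Rem. 9.3.5; Huber–Wüstholz 2022, App. A.3; Ayoub 2019, Rem. 1.3].
  The instance at the `θ₀`-class `⟦2π⟧ = ⟦∫₀¹ 8 dt/((t−1)²+1)⟧` of `SoloInformedPiSat.lean`
  (second conjunct = `SoloInformedPiSatTheta`) is the sequel file `SoloInformedLocSplitTheta.lean`.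

The hypotheses of `SoloInformedKZSaturation.lean` / `SoloInformedPiSat.lean` (separation of poles,
Nash cubulation) served only to identify conjunct (a) with Ayoub's conjecture on HIS presentation
by symbols; the splitting itself needs nothing.

References: M. Kontsevich, D. Zagier, *Periods* (2001), §1.2, §4.1; J. Ayoub, EMS Newsl. 91
(2014), Def. 10, Conj. 7, Prop. 11; J. Ayoub, Tohoku Math. J. 71 (2019), Rem. 1.3, 2.1.9–2.1.11;
A. Huber, S. Müller-Stach, *Periods and Nori motives* (2017), Def. 13.1.1, Rem. 9.3.5,
Prop. 13.2.21; A. Huber, G. Wüstholz, *Transcendence and linear relations of 1-periods* (2022),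
App. A.3.
-/

noncomputable section

open Literature.NumberTheory.Transcendental Literature.NumberTheory.Transcendental.KZ

namespace Summit.KontsevichZagierPeriods.KontsevichZagierPeriods.Theorems

/-! ### Pure algebra: injectivity = localised injectivity + cancellation -/

section Abstract

variable {R K : Type*} [CommRing R] [Field K]

/-- If `s` cancels (`s q = 0 → q = 0`) then so does every power of `s`. -/
theorem soloInformed_pow_cancel {s : R} (hs : ∀ q : R, s * q = 0 → q = 0) (n : ℕ) (q : R)
    (h : s ^ n * q = 0) : q = 0 := by
  induction n generalizing q with
  | zero => simpa using h
  | succ n ih =>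
    apply ih
    apply hs
    rw [← mul_assoc, ← pow_succ', h]

/-- If `s` cancels in `R` then `R → R[s⁻¹]` is injective. -/
theorem soloInformed_algebraMap_away_injective {s : R} (hs : ∀ q : R, s * q = 0 → q = 0) :
    Function.Injective (algebraMap R (Localization.Away s)) := by
  intro x y hxy
  obtain ⟨⟨c, n, rfl⟩, h⟩ := (IsLocalization.eq_iff_exists (Submonoid.powers s) _).1 hxy
  have h0 : s ^ n * (x - y) = 0 := by
    rw [mul_sub, sub_eq_zero]
    exact h
  exact sub_eq_zero.1 (soloInformed_pow_cancel hs n _ h0)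

/-- **Splitting lemma.**  For a ring map `f : R → K` to a field and `s ∈ R` with `f s ≠ 0`:
`f` is injective iff the induced map `R[s⁻¹] → K` is injective and `s` is a non-zero-divisor. -/
theorem soloInformed_injective_iff_loc_and_cancel (f : R →+* K) (s : R) (hfs : f s ≠ 0) :
    Function.Injective f ↔
      Function.Injective
          (IsLocalization.Away.lift s (isUnit_iff_ne_zero.2 hfs) : Localization.Away s →+* K) ∧
        ∀ q : R, s * q = 0 → q = 0 := by
  constructor
  · intro hinj
    have hs : ∀ q : R, s * q = 0 → q = 0 := by
      intro q hq
      have h0 : f s * f q = 0 := by rw [← map_mul, hq, map_zero]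
      rcases mul_eq_zero.1 h0 with h | h
      · exact absurd h hfs
      · exact hinj (by rw [h, map_zero])
    refine ⟨?_, hs⟩
    have hinjS := soloInformed_algebraMap_away_injective hs
    unfold IsLocalization.Away.lift
    exact (IsLocalization.lift_injective_iff _).mpr fun x y =>
      ⟨fun h => by rw [hinjS h], fun h => by rw [hinj h]⟩
  · rintro ⟨hloc, hs⟩
    have hinjS := soloInformed_algebraMap_away_injective hs
    intro x y hxy
    apply hinjS
    apply hloc
    rw [IsLocalization.Away.lift_eq, IsLocalization.Away.lift_eq]
    exact hxy

end Abstract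

/-! ### KZP as injectivity of `evalP`, and the splitting at any period of non-zero value -/

/-- **KZP ⟺ `evalP : P → ℝ` is injective.** [Kontsevich–Zagier 2001, §1.2, §4.1] -/
theorem soloInformed_kzp_iff_injective_evalP :
    KontsevichZagierPeriods ↔ Function.Injective evalP := by
  refine ⟨soloInformed_evalP_injective_of_kzp, fun hinj => ?_⟩
  refine KontsevichZagierPeriods_iff.2 (kzKernelConjecture_iff_isRational.1 fun c hc => ?_)
  rw [← toFormalPeriod_eq_zero_iff]
  apply hinj
  rw [evalP_toFormalPeriod, hc, map_zero]

/-- **The period conjecture for the LOCALISED ring `P[p⁻¹]`** (`evalP p ≠ 0`): the extension of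
`evalP` to `P[p⁻¹] → ℝ` is injective; equivalently (`soloInformed_kzLocAt_iff`), two formal
periods with the same value become equal in `P` after multiplication by a power of `p`.
A consequence of KZP (`soloInformed_kzLocAt_of_kzp`); for `p` of value `π` or `2π` it is the
naive form of the period conjecture for `P̂ = P[(2πi)⁻¹]`; OPEN.
[Kontsevich–Zagier 2001, §4.1; Ayoub 2014, Conj. 7] -/
def SoloInformedKZLocAt (p : FormalPeriodRing) (hp : evalP p ≠ 0) : Prop :=
  Function.Injective
    (IsLocalization.Away.lift p (isUnit_iff_ne_zero.2 hp) : Localization.Away p →+* ℝ)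

/-- Unfolding of `SoloInformedKZLocAt`: injectivity of `P[p⁻¹] → ℝ` says exactly that formal
periods with equal values are equal after multiplication by a power of `p`. -/
theorem soloInformed_kzLocAt_iff (p : FormalPeriodRing) (hp : evalP p ≠ 0) :
    SoloInformedKZLocAt p hp ↔
      ∀ x y : FormalPeriodRing, evalP x = evalP y → ∃ n : ℕ, p ^ n * x = p ^ n * y := by
  unfold SoloInformedKZLocAt IsLocalization.Away.lift
  rw [IsLocalization.lift_injective_iff]
  constructor
  · intro h x y hxy
    obtain ⟨⟨c, n, rfl⟩, hc⟩ :=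
      (IsLocalization.eq_iff_exists (Submonoid.powers p) (Localization.Away p)).1 ((h x y).2 hxy)
    exact ⟨n, hc⟩
  · intro h x y
    refine ⟨fun hxy => ?_, fun hxy => ?_⟩
    · obtain ⟨⟨c, n, rfl⟩, hc⟩ :=
        (IsLocalization.eq_iff_exists (Submonoid.powers p) (Localization.Away p)).1 hxy
      have hc' := congrArg evalP hc
      simp only [map_mul, map_pow] at hc'
      exact mul_left_cancel₀ (pow_ne_zero n hp) hc'
    · obtain ⟨n, hn⟩ := h x y hxy
      exact (IsLocalization.eq_iff_exists (Submonoid.powers p) (Localization.Away p)).2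
        ⟨⟨p ^ n, n, rfl⟩, hn⟩

/-- **THEOREM (localisation splitting of the summit, general element; no hypotheses).**
For every formal period `p` of non-zero value:
KZP ⟺ (period conjecture for `P[p⁻¹]`) ∧ (`p` is a non-zero-divisor of `P`). -/
theorem soloInformed_kzp_iff_loc_and_cancel (p : FormalPeriodRing) (hp : evalP p ≠ 0) :
    KontsevichZagierPeriods ↔
      SoloInformedKZLocAt p hp ∧ ∀ q : FormalPeriodRing, p * q = 0 → q = 0 :=
  soloInformed_kzp_iff_injective_evalP.trans (soloInformed_injective_iff_loc_and_cancel evalP p hp)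

/-- The localised conjecture is a consequence of KZP. -/
theorem soloInformed_kzLocAt_of_kzp (h : KontsevichZagierPeriods) (p : FormalPeriodRing)
    (hp : evalP p ≠ 0) : SoloInformedKZLocAt p hp :=
  ((soloInformed_kzp_iff_loc_and_cancel p hp).1 h).1

/-- Under the localised conjecture at one `p` of non-zero value, KZP ⟺ `KZSat` ⟺ "`p` cancels". -/
theorem soloInformed_kzp_iff_cancel_of_kzLocAt {p : FormalPeriodRing} {hp : evalP p ≠ 0}
    (hL : SoloInformedKZLocAt p hp) :
    KontsevichZagierPeriods ↔ ∀ q : FormalPeriodRing, p * q = 0 → q = 0 :=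
  ⟨fun h => ((soloInformed_kzp_iff_loc_and_cancel p hp).1 h).2,
    fun hc => (soloInformed_kzp_iff_loc_and_cancel p hp).2 ⟨hL, hc⟩⟩

/-! ### The instance `p = ⟦[π]⟧` and the Literature statement `KZ.PiCancellation` -/

/-- `evalP ⟦[π]⟧ ≠ 0`. -/
theorem soloInformed_evalP_piRep_ne_zero : evalP (toFormalPeriod (of piRep)) ≠ 0 := by
  rw [evalP_toFormalPeriod_of, piRep_value]
  exact Real.pi_ne_zero

/-- `KZ.PiCancellation` ("`[π]·c ∈ relations → c ∈ relations`") is literally "`⟦[π]⟧` is a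
non-zero-divisor of `P`". -/
theorem soloInformed_piCancellation_iff_cancel :
    PiCancellation ↔ ∀ q : FormalPeriodRing, toFormalPeriod (of piRep) * q = 0 → q = 0 := by
  constructor
  · intro h q hq
    obtain ⟨c, rfl⟩ := toFormalPeriod_surjective q
    rw [← map_mul, toFormalPeriod_eq_zero_iff] at hq
    exact toFormalPeriod_eq_zero_iff.2 (h c hq)
  · intro h c hc
    rw [← toFormalPeriod_eq_zero_iff, map_mul] at hc
    exact toFormalPeriod_eq_zero_iff.1 (h _ hc)

/-- `KZSat → KZ.PiCancellation` (so KZP → KZDomain → KZSat → PiCancellation). -/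
theorem soloInformed_piCancellation_of_kzSat (hS : SoloInformedKZSat) : PiCancellation :=
  soloInformed_piCancellation_iff_cancel.2 fun q hq => hS _ q soloInformed_evalP_piRep_ne_zero hq

/-- `KZP → KZ.PiCancellation` through the hierarchy. -/
theorem soloInformed_piCancellation_of_kzp (h : KontsevichZagierPeriods) : PiCancellation :=
  soloInformed_piCancellation_of_kzSat (soloInformed_kzSat_of_kzp h)

/-- **THEOREM (splitting at `⟦[π]⟧`; no hypotheses):**
KZP ⟺ (period conjecture for `P[⟦[π]⟧⁻¹]`) ∧ `KZ.PiCancellation`. -/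
theorem soloInformed_kzp_iff_locPi_and_piCancellation :
    KontsevichZagierPeriods ↔
      SoloInformedKZLocAt (toFormalPeriod (of piRep)) soloInformed_evalP_piRep_ne_zero ∧
        PiCancellation := by
  rw [soloInformed_piCancellation_iff_cancel]
  exact soloInformed_kzp_iff_loc_and_cancel _ _

/-- Under the localised conjecture at `⟦[π]⟧` alone, KZP ⟺ `KZ.PiCancellation`. -/
theorem soloInformed_kzp_iff_piCancellation_of_locPi
    (hL : SoloInformedKZLocAt (toFormalPeriod (of piRep)) soloInformed_evalP_piRep_ne_zero) :
    KontsevichZagierPeriods ↔ PiCancellation :=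
  ⟨soloInformed_piCancellation_of_kzp,
    fun hc => soloInformed_kzp_iff_locPi_and_piCancellation.2 ⟨hL, hc⟩⟩

end Summit.KontsevichZagierPeriods.KontsevichZagierPeriods.Theorems
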